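/-
Copyright (c) 2026 the pub-hodgecm-mathlib formalisation cell (harness21).  Prover seat hodgecm-mathlib-B-p08 (g41): req618 STAGE 1a «FOUR-FRAME» squad, dealer LH4-plan (g10)
WORD #8∕#9 deal g10-#15 «SLICES ASSEMBLY PORT»; HOME proof by F0P3a-p01 (g30) (law socket v1.5 481abd786a36bbea §6 `anchorRowsWild_of_slices`, l. 846–855); 2026-09-03.
-/
import Summits.HodgeConjecture.HodgeConjecture.Theorems.F0P3cDyRamFourFrameSocketDefs   -- ★ DEFS LEAF №2a «SOCKET» (dealer g10; filed LH4-p03): `AnchorRowsWild` (the conclusion, BY NAME)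
import Summits.HodgeConjecture.HodgeConjecture.Theorems.F0P3cDyRamFourFramePieces       -- ★ DEFS LEAF №3 «PIECES∕SLICES» (dealer g10 f0fa21fe9bedd6b5; filed LH4-p03): `PiecePropsWild`,
                                                                                      -- `RankTableWild`, `PieceRowsWild` (the three tier-0 slice Props, v1.5 §6 VERBATIM)
import HarnessLib

/-!
# Crux `H413`, line LH4 «(D-RAM) FOUR-FRAME» road, STAGE 1a — TIER-0 ASSEMBLY: the three slices ⟹ `AnchorRowsWild M`
# (★ tree twin of `F0/P3a/F0P3a-p01/g30/LAWSOCKET-DRAM-FourFrame.v1_5.F0P3ap01g30.lean` 481abd786a36bbea §6 `anchorRowsWild_of_slices`; deal g10-#15)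

Cell `hodgecm-mathlib` (D-0151), FLOOR 0, crux item H413 = `stmt-HodgeConjecture-24833`, route of record `HCCMUnconditional`; squad F0∕P3c∕LH4 (req618, director s1808),
dealer LH4-plan (g10) WORD #8 (5) ∕ WORD #9 deal g10-#15; heir LEAD F0P3a-plan DIRECTIVE v1.1 d3f1616d0136e728 (R-7) + T17-31 (R-8)–(R-11) + T17-34 (b6) («tier 0 = SIX registered
stubs + a sorry-free spine of THREE ★ ARROWS ONLY: `anchorRowsWild_of_slices` → `rankTransferWild_of_anchorRows` (★ p854606) → `dyRamCore_of_rankTransferWild` (★ p854617) →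
organ BY NAME»); author of the HOME proof F0P3a-p01 (g30), port B-p08 (g41).  THEOREMS ONLY (one theorem; no `def`, no instance, no notation, no named-fact hypothesis beyond
the stated antecedents, no `sorry`, default heartbeats — the HOME `maxHeartbeats 800000` is not needed); imports = ★ №2a `Theorems/F0P3cDyRamFourFrameSocketDefs.lean`
(`AnchorRowsWild`) + ★ №3 `Theorems/F0P3cDyRamFourFramePieces.lean` (`PiecePropsWild`, `RankTableWild`, `PieceRowsWild`) + HarnessLib; lane `--supports
stmt-HodgeConjecture-24833 --as helper` (count-neutral).

WHAT IS PROVED.  `anchorRowsWild_of_slices (M) (gsel) : PiecePropsWild M gsel → RankTableWild gsel → (∀ j, PieceRowsWild gsel j) → AnchorRowsWild M` — for ANY level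
schedule `M` and ANY finite family `gsel : Fin n → ‹piece selector›` of explicit pieces: if (U4-a) every piece is smooth, `K`-supported, `Ad K`-invariant and left-invariant
under the `ϖ_w`-adic level-`M(w)` congruence set; (U4-b) for every admissible unipotent datum `(S, mU)` there is an injective labelling `e : ↥S → Fin n` of the classes by pieces
with invertible orbital-integral table; and (U4-c) every piece carries, at every wild place and every unitary `μ` of the letter, ONE finite smooth `H`-family realising its three
POPULATION ROWS (type (1) ∕ type (2) ∕ Levi — the clause shapes of ★ `localTransferAtOne_of_populations`); then the ROWS INPUT `AnchorRowsWild M` of ★ №2a holds, with the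
reference pieces `g_u := gsel (e u)`.  PROOF (p01 (g30), 6 lines, carried verbatim): destructure (U4-b) to get `e` and the table; the four piece properties and the table are
read off; the rows of the piece `e u` are (U4-c) at `j = e u` (injectivity of `e` is not used by the composition — it is the rank layer's honesty).  In the line
`Cruxes/H413/Lines/F0_P3c_DyRamFourFrame.lean` (dealer, BY WRITE) this is the FIRST of the three ★ arrows: the six registered stubs `stub_rows_unit0∕edge∕transvection∕regular :
PieceRowsWild gselStar j`, `stub_pieceProps : PiecePropsWild mstarFn gselStar`, `stub_rankTableWild : RankTableWild gselStar` feed it at `gsel := gselStar`, `M := mstarFn`.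

HONEST LABEL.  Count-neutral: the three antecedents ARE the STAGE-1 typing∕proving debt (tier-1 units U0–U4 of T17-31 (R-9)); the verdict of record for (D-RAM) stays PRINT
[LanglandsShelstad1989 Thm. p. 484 ∕ Rogawski1990 Prop. 4.9.1 (a)] ∕ XL; `HC_CM` is proved only modulo the 7 printed citations (2 remaining: hLiu418 = `stmt-HodgeConjecture-24832`,
h413 = `stmt-HodgeConjecture-24833`) until rung 0 closes.

## References
* [Rogawski1990] J. D. Rogawski, *Automorphic Representations of Unitary Groups in Three Variables*, Ann. of Math. Stud. 123 (1990): §4.9 Prop. 4.9.1 (a) p. 55 (local transfer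
  at the identity), §8.1 (germ expansions; the unipotent orbital-integral table).
* [LanglandsShelstad1989] R. P. Langlands, D. Shelstad, *Orbital integrals on forms of SL(3), II*, Canad. J. Math. 41 (1989) 480–507: Theorem (end of §2) p. 484.
-/

noncomputable section

namespace Summit.HodgeConjecture.HodgeConjecture.Cruxes.H413.F0P3cDyRamAnchorRowsWildOfSlices

open MeasureTheory Measure NumberField IsDedekindDomain Topology Filter
open Literature.NumberTheory.Automorphic Literature.NumberTheory.Automorphic.UnitaryGroup Literature.NumberTheory.Automorphic.IntegralReduction
open Literature.NumberTheory.Automorphic.UnitaryLatticeTree Literature.NumberTheory.Automorphic.HermitianLattice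
open Literature.NumberTheory.Rogawski1990 Literature.NumberTheory.GaloisRepresentations
open Literature.MeasureTheory.Group (descConj)
open scoped Matrix MatrixGroups Classical ValuativeRel WithZero
open Summit.HodgeConjecture.HodgeConjecture.Cruxes.H413.F0P3cDyRamFourFrameSocketDefs
open Summit.HodgeConjecture.HodgeConjecture.Cruxes.H413.F0P3cDyRamFourFramePieces

/-- **U4 ASSEMBLY · `anchorRowsWild_of_slices` (PROVED): the three slices on a finite family of explicit pieces ⟹ `AnchorRowsWild M`** (`gref u := gsel (e u)` at the place;
injectivity of `e` is not even needed for the composition — it is part of the rank layer's honesty). -/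
theorem anchorRowsWild_of_slices (M : ∀ (L : Type) [Field L] [NumberField L] [IsCMField L] (v : HeightOneSpectrum (𝓞 ↥(maximalRealSubfield L))), UnitaryGroup.PlacesOver L v → ℕ) {n : ℕ} (gsel : Fin n → (∀ (L : Type) [Field L] [NumberField L] [IsCMField L] (v : HeightOneSpectrum (𝓞 ↥(maximalRealSubfield L))) (w : UnitaryGroup.PlacesOver L v), IsCMField.complexConj L • w.1 = w.1 → w.1.adicCompletion L → ((UnitaryGroup.cmDatum L 3 (Matrix.of fun i j : Fin 3 => if i.val + j.val + 1 = 3 then (1 : L) else 0)).Local v) → ℂ))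
    (hP : PiecePropsWild M gsel) (hR : RankTableWild gsel) (hRows : ∀ j, PieceRowsWild gsel j) : AnchorRowsWild M := by
  intro L _ _ _ v w hw he h2 ϖ hϖ _ _ _ _ S hS mU hmU hRao
  obtain ⟨e, -, htab⟩ := hR L w hw he h2 ϖ hϖ S hS mU hmU hRao
  refine ⟨fun u => (gsel (e u)) L v w hw ϖ, fun u => (hP L w hw he h2 ϖ hϖ (e u)).1, fun u => (hP L w hw he h2 ϖ hϖ (e u)).2.1,
    fun u => (hP L w hw he h2 ϖ hϖ (e u)).2.2.1, fun u => (hP L w hw he h2 ϖ hϖ (e u)).2.2.2, htab, ?_⟩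
  intro μ hμu hμω _ _ _ _ νH _ _ νG₃ _ _ mH mG₃ hmH hmG u
  exact hRows (e u) L w hw he h2 ϖ hϖ μ hμu hμω νH νG₃ mH mG₃ hmH hmG

end Summit.HodgeConjecture.HodgeConjecture.Cruxes.H413.F0P3cDyRamAnchorRowsWildOfSlices

end
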